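import Mathlib

/-!
# SoloBlind: the fixed-vector step of the socle lemma Ψ1

Companion to `SoloBlindSocleDichotomy`: on the all-plus Eisenstein torsion `J^N[𝔫⁺]` the kernel
of the cyclotomic character acts through elements `g` with `(g - 1)^2 = 0`, hence (in
characteristic `ℓ`) through an `ℓ`-group; an `ℓ`-group acting linearly on a non-zero
`𝔽_ℓ`-vector space has a non-zero fixed vector.  This is the abstract statement, proved by the
orbit-counting congruence `card V ≡ card V^G (mod ℓ)` (`IsPGroup.card_modEq_card_fixedPoints`)
together with `0 ∈ V^G`.
-/

namespace Summit.Langlands.Langlands.Theorems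

/-- The fixed-vector step of Ψ1: an `ℓ`-group acting linearly on a non-zero `𝔽_ℓ`-space fixes
a non-zero vector (orbit counting: `card V ≡ card V^G (mod ℓ)` and `0 ∈ V^G`). -/
theorem soloBlind_pgroup_fixed_vector (ℓ : ℕ) [hp : Fact ℓ.Prime] {G V : Type*} [Group G]
    [Finite G] [AddCommGroup V] [Module (ZMod ℓ) V] [Fintype V] [DistribMulAction G V]
    (hG : IsPGroup ℓ G) (hV : ∃ v : V, v ≠ 0) :
    ∃ v : V, v ≠ 0 ∧ ∀ g : G, g • v = v := by
  classical
  obtain ⟨v0, hv0⟩ := hV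
  have hdv : ℓ ∣ Nat.card V := by
    have h1 : addOrderOf v0 = ℓ :=
      addOrderOf_eq_prime (by rw [← Nat.cast_smul_eq_nsmul (ZMod ℓ), ZMod.natCast_self, zero_smul]) hv0
    rw [← h1]
    exact addOrderOf_dvd_natCard v0
  have hmod := hG.card_modEq_card_fixedPoints V
  have hdvF : ℓ ∣ Nat.card (MulAction.fixedPoints G V) := (hmod.dvd_iff dvd_rfl).mp hdv
  have h0mem : (0 : V) ∈ MulAction.fixedPoints G V := by
    rw [MulAction.mem_fixedPoints]; intro g; exact smul_zero g
  haveI : Nonempty (MulAction.fixedPoints G V) := ⟨⟨0, h0mem⟩⟩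
  have hpos : 0 < Nat.card (MulAction.fixedPoints G V) := Nat.card_pos
  have h2 : 1 < Nat.card (MulAction.fixedPoints G V) :=
    lt_of_lt_of_le hp.out.one_lt (Nat.le_of_dvd hpos hdvF)
  haveI : Nontrivial (MulAction.fixedPoints G V) := Finite.one_lt_card_iff_nontrivial.mp h2
  obtain ⟨⟨w, hw⟩, hne⟩ := exists_ne (⟨0, h0mem⟩ : MulAction.fixedPoints G V)
  refine ⟨w, ?_, fun g => (MulAction.mem_fixedPoints.mp hw g)⟩
  intro h0
  exact hne (Subtype.ext h0)

/-- Sanity instance: the trivial group (an `ℓ`-group for every `ℓ`) acting on `ZMod 5`. -/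
example : ∃ v : ZMod 5, v ≠ 0 ∧ ∀ g : Unit, g • v = v := by
  haveI : Fact (Nat.Prime 5) := ⟨by norm_num⟩
  letI : DistribMulAction Unit (ZMod 5) :=
    { smul := fun _ v => v, one_smul := fun _ => rfl, mul_smul := fun _ _ _ => rfl,
      smul_zero := fun _ => rfl, smul_add := fun _ _ _ => rfl }
  exact soloBlind_pgroup_fixed_vector 5 (G := Unit) (fun g => ⟨0, Subsingleton.elim _ _⟩) ⟨1, one_ne_zero⟩

end Summit.Langlands.Langlands.Theorems
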